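import Mathlib.Algebra.Module.Submodule.Ker
import Mathlib.Algebra.Module.LinearMap.End
import HarnessLib

/-!
# The character lattice of a torus QUOTIENT sits in the isotypic kernel with an Eisenstein index: the bookkeeping of 'X(T_Q)_𝔪 = S₀(L)_𝔪' (cell `b2b-bsdres`, seat additive-p4 gen 44, memo V76 §3 (b)–(c) / THETA-ROWS-ENDSTATE §5 (vii) — K131)

HONEST FRAMING (verbatim, cell `b2b-bsdres`): the goal of the cell is to DELETE the COMBINATION-SHAPED
residual classes for ALL analytic-rank `≤ 1` curves over `ℚ` — "full BSD formula for every rank `≤ 1`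
curve in class `C`" assembled STRICTLY from published theorems — so that the rank-`≤ 1` remainder
becomes exactly the CONSTRUCTION-SHAPED classes, which are TYPED (missing-input Props), NOT attempted;
this is not "finishing BSD". This file: TOOL theorems (pure module algebra; 0 defs, 0 facts, nothing
booked; X4 stays CONSTRUCTION-shaped; no mark moves). Thin by design: it isolates which part of the
(MO^θ) leaf's last sketch-level identification is bookkeeping and which part is geometry.

## Why

The (MO^θ) leaf of the θ-rows' END STATE is the kernel implication K126
(`nonempty_linearEquiv_of_ribetData`) run on the θ-new QUOTIENT `Q` of the syntheme curve; its one
sketch-level input is the identification of character lattices `X(T_Q)_𝔪 = S₀(L)_𝔪` at a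
non-Eisenstein maximal ideal `𝔪` (memo V76 §3; THETA-ROWS-ENDSTATE §5 (vii)). The argument there: with
`T_B = K⁰ ⊂ K ⊂ T_J` (tori of the special fibres of `B = u^*J₀(ℓ₂L) ⊂ J_Γ ↠ Q`, `K = ker(T_J → T_Q)`,
`F = K/K⁰` finite), restriction of characters gives `ρ : X(T_J) → X(K)` and `π : X(K) → X(K⁰) = X(L)`
with `ker π = X(F)`; then `X(T_Q) = ker ρ`, `S₀(L) = ker(π ∘ ρ) = ker u_*`, and `F ↪ Φ(J₀(ℓ₂L))`, which is
EISENSTEIN (Ribet 1990 Thm 3.12: killed by `η_r = T_r − r − 1`), while `𝔪` is not (`ρ̄` irreducible: some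
`η_r ∉ 𝔪`). This file is exactly the module algebra of that paragraph, for linear maps
`ρ : M → N`, `π : N → P` over a commutative ring `R` and a scalar `η`:

* `ker_le_ker_comp'` — `ker ρ ≤ ker (π ∘ ρ)` (`X(T_Q) ⊆ S₀`);
* `smul_mem_ker_of_mem_ker_comp` — if `η` kills `ker π` then `η • (ker (π ∘ ρ)) ⊆ ker ρ`: THE INDEX
  `S₀/X(T_Q)` IS KILLED BY `η` (it embeds in `ker π = X(F)`);
* `ker_comp_eq_ker_of_isUnit` — if moreover `η` is a UNIT of `R` (the situation after localising at a
  maximal ideal not containing `η`, i.e. at a non-Eisenstein `𝔪`; the module hypotheses are stable under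
  that base change) then `ker (π ∘ ρ) = ker ρ`: **`X(T_Q)_𝔪 = S₀(L)_𝔪`**;
* `smul_eq_zero_of_injective` — `η` kills a module that embeds `η`-equivariantly into an `η`-torsion
  module (`F ↪ Φ`, `Φ` Eisenstein ⟹ `ηF = 0`);
* `smul_linearMap_eq_zero_of_forall_smul_eq_zero` — and then `η` kills every `R`-linear `F → C`
  (the character group `X(F) = Hom(F, 𝔾_m)` with its induced Hecke action: `(ηf)(x) = f(ηx) = 0`).

Reading (displayed in memo V76 §3, not here): `M = X(T_J) = X_perm(L)` [Deligne–Rapoport VI.6.9 /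
Ribet 1990 Props. 2.1–2.2 / Diamond 1997 §3 p. 30 — PUB-pattern], `N = X(K)`, `P = X(K⁰) = X(L)`,
`ρ, π` = restriction of characters [SGA7 IX; surjective for closed subgroups of multiplicative type],
`K⁰ = T_B` [uses the Néron closed immersion `𝒩(B) → 𝒩(J_Γ)`: Raynaud `e < p − 1` for `ℓ₂` odd, BLR §7.5 in
general — the ONE non-printed step], `F ↪ Φ_B ≅ Φ(J₀(ℓ₂L))` [the abelian part contributes nothing:
`u_s^*` injective], `η = T_r − r − 1 ∉ 𝔪` [Ribet Thm 3.12 + `ρ̄` irreducible]. What this file does NOT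
do: any of those identifications. No number theory enters.

## References

* K. A. Ribet, Invent. Math. 100 (1990), Props. 2.1–2.2, Thm. 3.12. [cite: Ribet1990, Thm. 3.12 (p. 449)]
* A. Grothendieck, SGA 7 I, exp. IX (models of Néron type; character groups of tori). [folklore]
-/

namespace Summit.BirchSwinnertonDyer.Rank1Residual.LevelLowering

variable {R : Type*} [CommRing R]
  {M N P : Type*} [AddCommGroup M] [Module R M] [AddCommGroup N] [Module R N]
  [AddCommGroup P] [Module R P]

/-! ### §1 The quotient lattice inside the isotypic kernel, and its index -/

/-- `X(T_Q) = ker ρ ⊆ ker (π ∘ ρ) = S₀`. [folklore] -/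
theorem ker_le_ker_comp' (ρ : M →ₗ[R] N) (π : N →ₗ[R] P) :
    LinearMap.ker ρ ≤ LinearMap.ker (π ∘ₗ ρ) := by
  intro x hx
  rw [LinearMap.mem_ker] at hx ⊢
  rw [LinearMap.comp_apply, hx, map_zero]

/-- **The index `S₀/X(T_Q)` is killed by `η`**: if `η` annihilates `ker π` (`= X(F)`, `F` Eisenstein)
then `η • b ∈ ker ρ` for every `b ∈ ker (π ∘ ρ)` (`ρ b ∈ ker π`, so `ρ(ηb) = η ρ b = 0`).
[cite: Ribet1990, Thm. 3.12 (p. 449)] -/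
theorem smul_mem_ker_of_mem_ker_comp (ρ : M →ₗ[R] N) (π : N →ₗ[R] P) {η : R}
    (hπ : ∀ y ∈ LinearMap.ker π, η • y = 0) {b : M} (hb : b ∈ LinearMap.ker (π ∘ₗ ρ)) :
    η • b ∈ LinearMap.ker ρ := by
  rw [LinearMap.mem_ker, LinearMap.comp_apply] at hb
  rw [LinearMap.mem_ker, map_smul]
  exact hπ (ρ b) (LinearMap.mem_ker.mpr hb)

/-- **`X(T_Q)_𝔪 = S₀(L)_𝔪`**: if `η` annihilates `ker π` and `η` is a UNIT of the coefficient ring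
(after localisation at a maximal ideal `𝔪 ∌ η` — a non-Eisenstein `𝔪`), then `ker (π ∘ ρ) = ker ρ`:
`b = η⁻¹(ηb)` with `ηb ∈ ker ρ`. [cite: Ribet1990, Thm. 3.12 (p. 449)] -/
theorem ker_comp_eq_ker_of_isUnit (ρ : M →ₗ[R] N) (π : N →ₗ[R] P) {η : R} (hη : IsUnit η)
    (hπ : ∀ y ∈ LinearMap.ker π, η • y = 0) :
    LinearMap.ker (π ∘ₗ ρ) = LinearMap.ker ρ := by
  refine le_antisymm (fun b hb ↦ ?_) (ker_le_ker_comp' ρ π)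
  obtain ⟨u, rfl⟩ := hη
  have hub : (u : R) • b ∈ LinearMap.ker ρ := smul_mem_ker_of_mem_ker_comp ρ π hπ hb
  have hb' : ((u⁻¹ : Rˣ) : R) • ((u : R) • b) = b := by
    rw [smul_smul, Units.inv_mul, one_smul]
  rw [← hb']
  exact Submodule.smul_mem _ _ hub

/-- The same conclusion phrased on elements: under the hypotheses of `ker_comp_eq_ker_of_isUnit`,
`π (ρ b) = 0` already forces `ρ b = 0`. [folklore] -/
theorem map_eq_zero_of_comp_eq_zero_of_isUnit (ρ : M →ₗ[R] N) (π : N →ₗ[R] P) {η : R}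
    (hη : IsUnit η) (hπ : ∀ y ∈ LinearMap.ker π, η • y = 0) {b : M} (hb : π (ρ b) = 0) :
    ρ b = 0 := by
  have h : b ∈ LinearMap.ker (π ∘ₗ ρ) := by
    rw [LinearMap.mem_ker, LinearMap.comp_apply, hb]
  rw [ker_comp_eq_ker_of_isUnit ρ π hη hπ] at h
  exact LinearMap.mem_ker.mp h

/-! ### §2 Where the annihilation comes from: Eisenstein ambient module, then duality -/

/-- **`F ↪ Φ` with `Φ` killed by `η` ⟹ `F` killed by `η`** (an `R`-linear injection into an
`η`-torsion module). [cite: Ribet1990, Thm. 3.12 (p. 449)] -/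
theorem smul_eq_zero_of_injective {F Φ : Type*} [AddCommGroup F] [Module R F] [AddCommGroup Φ]
    [Module R Φ] (i : F →ₗ[R] Φ) (hi : Function.Injective i) {η : R}
    (hΦ : ∀ z : Φ, η • z = 0) (x : F) : η • x = 0 := by
  apply hi
  rw [map_smul, hΦ, map_zero]

/-- **Duality**: if `η` kills `F` then `η` kills every `R`-linear map `F → C` — the induced action on
the character group `X(F) = Hom(F, ·)` (`(η • f) x = η • f x = f (η • x) = 0`). [folklore] -/
theorem smul_linearMap_eq_zero_of_forall_smul_eq_zero {F C : Type*} [AddCommGroup F] [Module R F]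
    [AddCommGroup C] [Module R C] {η : R} (hF : ∀ x : F, η • x = 0) (f : F →ₗ[R] C) :
    η • f = 0 := by
  ext x
  rw [LinearMap.smul_apply, LinearMap.zero_apply, ← map_smul, hF, map_zero]

/-- **The chain assembled**: `ker π` embeds `R`-linearly into a module of `R`-linear maps `F → C`
(`X(F)`), `F` embeds into an `η`-torsion module `Φ` (Eisenstein component group), and `η` is a unit
(non-Eisenstein localisation) ⟹ `ker (π ∘ ρ) = ker ρ`, i.e. `X(T_Q)_𝔪 = S₀(L)_𝔪`. The three embeddings
are the displayed hypotheses; nothing geometric is proved here. [cite: Ribet1990, Thm. 3.12 (p. 449)] -/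
theorem ker_comp_eq_ker_of_eisenstein {F Φ C : Type*} [AddCommGroup F] [Module R F]
    [AddCommGroup Φ] [Module R Φ] [AddCommGroup C] [Module R C]
    (ρ : M →ₗ[R] N) (π : N →ₗ[R] P) {η : R} (hη : IsUnit η)
    (j : LinearMap.ker π →ₗ[R] (F →ₗ[R] C)) (hj : Function.Injective j)
    (i : F →ₗ[R] Φ) (hi : Function.Injective i) (hΦ : ∀ z : Φ, η • z = 0) :
    LinearMap.ker (π ∘ₗ ρ) = LinearMap.ker ρ := by
  refine ker_comp_eq_ker_of_isUnit ρ π hη fun y hy ↦ ?_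
  have hF : ∀ x : F, η • x = 0 := smul_eq_zero_of_injective i hi hΦ
  have h1 : η • j ⟨y, hy⟩ = 0 := smul_linearMap_eq_zero_of_forall_smul_eq_zero hF _
  have h2 : j (η • ⟨y, hy⟩) = 0 := by rw [map_smul, h1]
  have h3 : η • (⟨y, hy⟩ : LinearMap.ker π) = 0 := hj (by rw [h2, map_zero])
  exact congrArg Subtype.val h3

end Summit.BirchSwinnertonDyer.Rank1Residual.LevelLowering
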